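import Mathlib
import Summits.NavierStokesRegularity.NavierStokesRegularity.Theorems.SubOnsagerCeilingKPSideBranchClassDynamics
import Summits.NavierStokesRegularity.NavierStokesRegularity.Theorems.SubOnsagerCeilingKPFluxBudget
import HarnessLib

/-!
# ENERGY STARVATION by a strong dead-end pump: a recurrent corner of both registered stubs at EVERY scale ratio
# (helper file for the crux `SubOnsagerCeiling.ForwardTailCeilingKP`, stmt-NavierStokesRegularity-27057, `--supports`)

THE DEAD-END PUMP CLASS (def-free, by coefficient hypotheses on a KP network proper `α ∈ E₂(R)`: symmetric,
cancelling, orthant, diagonal feeds): the Katz–Pavlović chain on component `0` (forward feed `x²_{0,k} → x_{0,k+1}`,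
weight `c₀ > 0`), an in-shell DIAGONAL PUMP `x²_{0,k} → x_{1,k}` of weight `P ≥ 0` into the DEAD-END component `1`
(no forward feed, no exit), no other coupling (components `2, 3` inert).  It is the side-branch class of
`Theorems/SubOnsagerCeilingKPSideBranchClass*.lean` with exit weight `f = 0`, i.e. a chain with a dead-end exit of
ARBITRARY size at every shell — one of the recurrent architectures listed as uncovered by the LEAD census (RUNG 5 / 9
need a SMALL pump `13P² < f²κ⁴`, `5Pκb^{5/2} ≤ c₀b^{2θ}` and `b ∈ [1.78, 2]`).

THE MECHANISM (new for this crux; no invariant region): along every honest non-negative viscous solution,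
* `deadEndPump_side_ge` — the parked side amplitude dominates the next chain amplitude, `x_{1,k} ≥ (P/c₀)·x_{0,k+1}`
  on `[0,s]` for every shell `k ≥ 1` (both are driven by `Λ_k x²_{0,k}` with weights `P`, `c₀`; the chain mode is
  drained in addition and dissipated faster; one-sided Grönwall on `e^{ν_k t}(x_{1,k} − (P/c₀)x_{0,k+1})`);
* hence the pump power `PΛ_k x²_{0,k} x_{1,k}` is at least `P²/c₀²` times the onward chain power
  `c₀Λ_k x²_{0,k} x_{0,k+1}` at every instant, and the single-mode energy balance of `x_{0,k}`
  (`deadEndPump_outflux_le_influx`) gives the GEOMETRIC STARVATION of the bond fluxes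
  `Φ_{k+1}(t) ≤ q·Φ_k(t)`, `q = c₀²/(c₀²+P²)` (`deadEndPump_flux_step`, `deadEndPump_flux_le`), `Φ_1 ≤ E₀`;
* the sequel `Theorems/SubOnsagerCeilingKPDeadEndPumpBarrier.lean` combines this with the band bound
  `Σ_i ½X_{i,k}(t)² ≤ Φ_k(t)` (`kpProper_bandEnergy_le_gateFlux`) into the ν-UNIFORM SHELL BARRIER `ShellBarrierAt R ε₀ α`
  with `(1+ε₀)^{2θ} = 1 + P²/c₀²`, `D = 1 + P²/c₀²` — `θ > 1/2` exactly when `P² > ε₀·c₀²`, at EVERY scale ratio,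
  in particular throughout the small-ratio regime `ε₀ ≤ 1/4` as soon as `P > c₀/2`.

Complementary to the region rungs: those cover SMALL pumps near `b = 2`, starvation covers LARGE pumps (`P/c₀ > √ε₀`)
at all `b`; the window `P/c₀ ≤ √ε₀` with `f = 0` remains.
HONEST FRAMING: statements about Tao-type MODEL lattice ODEs (route SubOnsagerCeiling, rung TL-M2Break); one
architecture class; no stub, crux or summit is proved and nothing here bears on Navier–Stokes regularity.
[cite: Tao2016AveragedNS, §4 (4.2)–(4.3), (4.8), (4.13)] [cite: Teschl2012, §2.4 (Grönwall)]
-/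

noncomputable section

-- the sub-problem namespace `NavierStokesRegularity.NavierStokesRegularity` is the tree's layout (D-0017)
set_option linter.dupNamespace false

namespace Summit.NavierStokesRegularity.NavierStokesRegularity.Theorems

open Set Finset MeasureTheory intervalIntegral
open scoped Topology
open Literature.Analysis.FluidPDE.TaoCascade

section DeadEndPump

variable {α : Fin 4 → Fin 4 → Fin 4 → ℤ × ℤ × ℤ → ℝ} {c₀ P : ℝ}

/-- In the dead-end pump class the forward feeds have the side-branch-class shape with exit weight `f = 0`.
[this file] -/
theorem deadEndPump_hw (hw : ∀ a c : Fin 4, α a a c (0, 0, 1) = if a = 0 ∧ c = 0 then c₀ else 0) :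
    ∀ a c : Fin 4, α a a c (0, 0, 1) =
      (if a = 0 ∧ c = 0 then c₀ else 0) + (if a = 1 ∧ c = 2 then (0 : ℝ) else 0) := by
  intro a c
  rw [hw a c]
  simp

/-- The gate flux of the class through the bond `m → m+1` is the chain flux `c₀Λ_m x²_{0,m} x_{0,m+1}`.
[this file] -/
theorem deadEndPump_gateFlux (hw : ∀ a c : Fin 4, α a a c (0, 0, 1) = if a = 0 ∧ c = 0 then c₀ else 0)
    (ε₀ : ℝ) (X : Fin 4 → ℤ → ℝ → ℝ) (m : ℕ) (τ : ℝ) :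
    (1 + ε₀) ^ ((5 : ℝ) * (m : ℝ) / 2) * ∑ i, ∑ j, α i i j (0, 0, 1) * X i (m : ℤ) τ ^ 2 * X j ((m : ℤ) + 1) τ =
      (1 + ε₀) ^ ((5 : ℝ) * (m : ℝ) / 2) * (c₀ * X 0 (m : ℤ) τ ^ 2 * X 0 ((m : ℤ) + 1) τ) := by
  congr 1
  simp only [hw, Fin.sum_univ_four]
  simp

variable (hs : IsSymmetricCoeff α) (hc : IsCancellingCoeff α)
  (hO : ∀ (Y : Fin 4 → ℤ → ℝ → ℝ) (τ : ℝ), (∀ (j : Fin 4) (k : ℤ), 1 ≤ k → 0 ≤ Y j k τ) →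
    ∀ δ : ℝ, 0 < δ → ∀ (i : Fin 4) (n : ℤ), 1 ≤ n → Y i n τ = 0 → 0 ≤ quadTerm δ α Y i n τ)
  (hD : ∀ a b i : Fin 4, a ≠ b → α a b i (0, 0, 1) = 0)
  (hw : ∀ a c : Fin 4, α a a c (0, 0, 1) = if a = 0 ∧ c = 0 then c₀ else 0)
  (hP : ∀ a c : Fin 4, a ≠ c → α a a c (0, 0, 0) = if a = 0 ∧ c = 1 then P else 0)
  (hCz : ∀ a b c : Fin 4, a ≠ b → a ≠ c → b ≠ c → α a b c (0, 0, 0) = 0)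
include hs hc hO hD hw hP hCz

/-- **The parked side amplitude dominates the next chain amplitude**: along an honest non-negative `ν`-viscous
solution (`ν ≥ 0`, `c₀ > 0`, `P ≥ 0`, `1 + ε₀ ≥ 1`), for every shell `n ≥ 1` and `t ∈ [0,s]`:
`(P/c₀)·x_{0,n+1}(t) ≤ x_{1,n}(t)`.  (`u = x_{1,n} − (P/c₀)x_{0,n+1}` has `u(0) = 0` and
`u' + ν(1+ε₀)^{2n}u ≥ 0`.) [cite: Teschl2012, §2.4 (Grönwall)] -/
theorem deadEndPump_side_ge {ε₀ ν s : ℝ} (hε : 0 ≤ ε₀) (hν : 0 ≤ ν) (hc₀ : 0 < c₀) (hP0 : 0 ≤ P)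
    {X₀ : Fin 4 → ℝ} {X : Fin 4 → ℤ → ℝ → ℝ}
    (hdat : ∀ (i : Fin 4) (k : ℤ), X i k 0 = if k = 0 then X₀ i else 0)
    (hode : ∀ (i : Fin 4) (k : ℤ), ∀ t ∈ Icc (0 : ℝ) s, HasDerivWithinAt (X i k)
      (quadTerm ε₀ α X i k t - ν * (1 + ε₀) ^ ((2 : ℝ) * k) * X i k t) (Icc (0 : ℝ) s) t)
    (hnn : ∀ t ∈ Icc (0 : ℝ) s, ∀ (i : Fin 4) (k : ℤ), 1 ≤ k → 0 ≤ X i k t)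
    {n : ℤ} (hn : 1 ≤ n) : ∀ t ∈ Icc (0 : ℝ) s, P / c₀ * X 0 (n + 1) t ≤ X 1 n t := by
  have hw' := deadEndPump_hw hw
  set κ : ℝ := ν * (1 + ε₀) ^ ((2 : ℝ) * n) with hκ
  set κ' : ℝ := ν * (1 + ε₀) ^ ((2 : ℝ) * ((n + 1 : ℤ) : ℝ)) with hκ'
  have hb1 : (1 : ℝ) ≤ 1 + ε₀ := by linarith
  have hκκ' : κ ≤ κ' := by
    simp only [hκ, hκ']
    refine mul_le_mul_of_nonneg_left (Real.rpow_le_rpow_of_exponent_le hb1 ?_) hν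
    push_cast
    linarith
  -- `u = x_{1,n} − (P/c₀) x_{0,n+1}`, `G = e^{κ t} u`
  set u : ℝ → ℝ := fun τ => X 1 n τ - P / c₀ * X 0 (n + 1) τ with hu
  set u' : ℝ → ℝ := fun τ =>
    (P * (1 + ε₀) ^ ((5 : ℝ) * n / 2) * (X 0 n τ * X 0 n τ) -
        0 * (1 + ε₀) ^ ((5 : ℝ) * n / 2) * (X 1 n τ * X 2 (n + 1) τ) - κ * X 1 n τ) -
      P / c₀ * (c₀ * (1 + ε₀) ^ ((5 : ℝ) * ((((n + 1 : ℤ)) : ℝ) - 1) / 2) * X 0 (n + 1 - 1) τ ^ 2 -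
        c₀ * (1 + ε₀) ^ ((5 : ℝ) * ((n + 1 : ℤ) : ℝ) / 2) * (X 0 (n + 1) τ * X 0 (n + 1 + 1) τ) -
        P * (1 + ε₀) ^ ((5 : ℝ) * ((n + 1 : ℤ) : ℝ) / 2) * (X 0 (n + 1) τ * X 1 (n + 1) τ) -
        κ' * X 0 (n + 1) τ) with hu'
  have hud : ∀ τ ∈ Icc (0 : ℝ) s, HasDerivWithinAt u (u' τ) (Icc 0 s) τ := by
    intro τ hτ
    have h1 := hode 1 n τ hτ
    rw [sideClass_quadTerm_side hs hc hO hD hw' hP hCz] at h1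
    have h0 := hode 0 (n + 1) τ hτ
    rw [sideClass_quadTerm_chain hs hc hO hD hw' hP hCz] at h0
    exact h1.sub (h0.const_mul (P / c₀))
  -- the key sign: `u' + κ u ≥ 0`
  have hkey : ∀ τ ∈ Icc (0 : ℝ) s, 0 ≤ u' τ + κ * u τ := by
    intro τ hτ
    have hx1 : 0 ≤ X 0 (n + 1) τ := hnn τ hτ 0 _ (by omega)
    have hx2 : 0 ≤ X 0 (n + 1 + 1) τ := hnn τ hτ 0 _ (by omega)
    have hy1 : 0 ≤ X 1 (n + 1) τ := hnn τ hτ 1 _ (by omega)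
    have hΛ : 0 ≤ (1 + ε₀) ^ ((5 : ℝ) * ((n + 1 : ℤ) : ℝ) / 2) := by positivity
    have hsimp : u' τ + κ * u τ =
        P / c₀ * (c₀ * (1 + ε₀) ^ ((5 : ℝ) * ((n + 1 : ℤ) : ℝ) / 2) * (X 0 (n + 1) τ * X 0 (n + 1 + 1) τ) +
          P * (1 + ε₀) ^ ((5 : ℝ) * ((n + 1 : ℤ) : ℝ) / 2) * (X 0 (n + 1) τ * X 1 (n + 1) τ)) +
          P / c₀ * (κ' - κ) * X 0 (n + 1) τ := by
      have hidx : (n + 1 - 1 : ℤ) = n := by omega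
      have hexp : ((5 : ℝ) * ((((n + 1 : ℤ)) : ℝ) - 1) / 2) = (5 : ℝ) * n / 2 := by push_cast; ring
      simp only [hu, hu', hidx, hexp]
      field_simp
      ring
    rw [hsimp]
    have hPc : 0 ≤ P / c₀ := div_nonneg hP0 hc₀.le
    have hA : 0 ≤ c₀ * (1 + ε₀) ^ ((5 : ℝ) * ((n + 1 : ℤ) : ℝ) / 2) * (X 0 (n + 1) τ * X 0 (n + 1 + 1) τ) +
        P * (1 + ε₀) ^ ((5 : ℝ) * ((n + 1 : ℤ) : ℝ) / 2) * (X 0 (n + 1) τ * X 1 (n + 1) τ) := by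
      positivity
    have hB : 0 ≤ P / c₀ * (κ' - κ) * X 0 (n + 1) τ :=
      mul_nonneg (mul_nonneg hPc (by linarith)) hx1
    exact add_nonneg (mul_nonneg hPc hA) hB
  -- `G = e^{κ t} u` is monotone on `[0,s]`
  set G : ℝ → ℝ := fun τ => Real.exp (κ * τ) * u τ with hG
  set G' : ℝ → ℝ := fun τ => Real.exp (κ * τ) * (u' τ + κ * u τ) with hG'
  have hGd : ∀ τ ∈ Icc (0 : ℝ) s, HasDerivWithinAt G (G' τ) (Icc 0 s) τ := by
    intro τ hτ
    have he : HasDerivWithinAt (fun θ => Real.exp (κ * θ)) (Real.exp (κ * τ) * κ) (Icc 0 s) τ := by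
      have := ((hasDerivAt_id τ).const_mul κ).exp
      simpa using this.hasDerivWithinAt
    have h := he.mul (hud τ hτ)
    refine h.congr_deriv ?_
    simp only [hG']
    ring
  have hGmono : MonotoneOn G (Icc 0 s) := by
    have hGcont : ContinuousOn G (Icc 0 s) := fun τ hτ => (hGd τ hτ).continuousWithinAt
    refine monotoneOn_of_hasDerivWithinAt_nonneg (f' := G') (convex_Icc 0 s) hGcont ?_ ?_
    · intro x hx
      rw [interior_Icc] at hx ⊢
      exact (hGd x (Ioo_subset_Icc_self hx)).mono Ioo_subset_Icc_self
    · intro x hx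
      rw [interior_Icc] at hx
      exact mul_nonneg (Real.exp_pos _).le (hkey x (Ioo_subset_Icc_self hx))
  have hG0 : G 0 = 0 := by
    have h1 : X 1 n 0 = 0 := by rw [hdat]; simp; omega
    have h2 : X 0 (n + 1) 0 = 0 := by rw [hdat]; simp; omega
    simp [hG, hu, h1, h2]
  intro t ht
  have hGt : 0 ≤ G t := by
    rw [← hG0]
    exact hGmono ⟨le_rfl, ht.1.trans ht.2⟩ ht ht.1
  have hexp : 0 < Real.exp (κ * t) := Real.exp_pos _
  have hut : 0 ≤ u t := by
    by_contra hh
    push Not at hh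
    have : G t < 0 := by simp only [hG]; nlinarith [mul_pos hexp (neg_pos.2 hh)]
    linarith
  simp only [hu] at hut
  linarith

/-- **Geometric starvation of the bond fluxes** (one step): along an honest non-negative `ν`-viscous solution
from a one-shell datum (`ν ≥ 0`, `c₀ > 0`, `P ≥ 0`, `ε₀ ≥ 0`), for every bond `m+1 → m+2` (`m : ℕ`) and
`t ∈ [0,s]`: `(1 + P²/c₀²)·Φ_{m+2}(t) ≤ Φ_{m+1}(t)`, where `Φ_{k+1}(t) = ∫₀ᵗ (1+ε₀)^{5k/2} c₀ x²_{0,k} x_{0,k+1}` is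
the energy carried through the bond `k → k+1` up to time `t` (single-mode energy balance of `x_{0,m+1}`: in-flux
= stored + onward flux + pump work + dissipation, and pump work `≥ (P²/c₀²)·` onward flux by
`deadEndPump_side_ge`). [cite: Tao2016AveragedNS, §4 (4.8)–(4.9), (4.13)] -/
theorem deadEndPump_flux_step {ε₀ ν s : ℝ} (hε : 0 ≤ ε₀) (hν : 0 ≤ ν) (hc₀ : 0 < c₀) (hP0 : 0 ≤ P)
    {X₀ : Fin 4 → ℝ} {X : Fin 4 → ℤ → ℝ → ℝ}
    (hdat : ∀ (i : Fin 4) (k : ℤ), X i k 0 = if k = 0 then X₀ i else 0)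
    (hXc : ∀ (i : Fin 4) (k : ℤ), Continuous (X i k))
    (hode : ∀ (i : Fin 4) (k : ℤ), ∀ t ∈ Icc (0 : ℝ) s, HasDerivWithinAt (X i k)
      (quadTerm ε₀ α X i k t - ν * (1 + ε₀) ^ ((2 : ℝ) * k) * X i k t) (Icc (0 : ℝ) s) t)
    (hnn : ∀ t ∈ Icc (0 : ℝ) s, ∀ (i : Fin 4) (k : ℤ), 1 ≤ k → 0 ≤ X i k t) (m : ℕ) :
    ∀ t ∈ Icc (0 : ℝ) s,
      (1 + P ^ 2 / c₀ ^ 2) * ∫ τ in (0 : ℝ)..t, (1 + ε₀) ^ ((5 : ℝ) * ((m : ℝ) + 1) / 2) *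
          (c₀ * X 0 ((m : ℤ) + 1) τ ^ 2 * X 0 ((m : ℤ) + 2) τ) ≤
        ∫ τ in (0 : ℝ)..t, (1 + ε₀) ^ ((5 : ℝ) * (m : ℝ) / 2) * (c₀ * X 0 (m : ℤ) τ ^ 2 * X 0 ((m : ℤ) + 1) τ) := by
  have hw' := deadEndPump_hw hw
  have hb : (0 : ℝ) < 1 + ε₀ := by linarith
  -- notation: the shell `n = m+1` and its neighbours
  set Λm : ℝ := (1 + ε₀) ^ ((5 : ℝ) * (m : ℝ) / 2) with hΛm
  set Λn : ℝ := (1 + ε₀) ^ ((5 : ℝ) * ((m : ℝ) + 1) / 2) with hΛn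
  set κ : ℝ := ν * (1 + ε₀) ^ ((2 : ℝ) * ((m : ℝ) + 1)) with hκ
  have hΛn0 : 0 ≤ Λn := by positivity
  have hκ0 : 0 ≤ κ := by positivity
  set x : ℝ → ℝ := fun τ => X 0 ((m : ℤ) + 1) τ with hx
  set xm : ℝ → ℝ := fun τ => X 0 (m : ℤ) τ with hxm
  set xn : ℝ → ℝ := fun τ => X 0 ((m : ℤ) + 2) τ with hxn
  set y : ℝ → ℝ := fun τ => X 1 ((m : ℤ) + 1) τ with hy
  have hxc : Continuous x := hXc 0 _
  have hxmc : Continuous xm := hXc 0 _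
  have hxnc : Continuous xn := hXc 0 _
  have hyc : Continuous y := hXc 1 _
  -- the equation of the chain mode at shell `m+1`
  have hxd : ∀ τ ∈ Icc (0 : ℝ) s, HasDerivWithinAt x
      (c₀ * Λm * xm τ ^ 2 - c₀ * Λn * (x τ * xn τ) - P * Λn * (x τ * y τ) - κ * x τ) (Icc 0 s) τ := by
    intro τ hτ
    have h0 := hode 0 ((m : ℤ) + 1) τ hτ
    rw [sideClass_quadTerm_chain hs hc hO hD hw' hP hCz] at h0
    have hidx : ((m : ℤ) + 1 - 1) = (m : ℤ) := by omega
    have hidx2 : ((m : ℤ) + 1 + 1) = (m : ℤ) + 2 := by ring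
    have he1 : ((5 : ℝ) * ((((m : ℤ) + 1 : ℤ) : ℝ) - 1) / 2) = (5 : ℝ) * (m : ℝ) / 2 := by push_cast; ring
    have he2 : ((5 : ℝ) * (((m : ℤ) + 1 : ℤ) : ℝ) / 2) = (5 : ℝ) * ((m : ℝ) + 1) / 2 := by push_cast; ring
    have he3 : ((2 : ℝ) * (((m : ℤ) + 1 : ℤ) : ℝ)) = (2 : ℝ) * ((m : ℝ) + 1) := by push_cast; ring
    rw [hidx, hidx2, he1, he2, he3] at h0
    refine h0.congr_deriv ?_
    simp only [hΛm, hΛn, hκ, hx, hxm, hxn, hy]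
  -- fluxes
  set IN : ℝ → ℝ := fun τ => Λm * (c₀ * xm τ ^ 2 * x τ) with hIN
  set OUTC : ℝ → ℝ := fun τ => Λn * (c₀ * x τ ^ 2 * xn τ) with hOUTC
  set OUTP : ℝ → ℝ := fun τ => P * Λn * (x τ ^ 2 * y τ) with hOUTP
  set VISC : ℝ → ℝ := fun τ => κ * x τ ^ 2 with hVISC
  have hINc : Continuous IN := continuous_const.mul ((continuous_const.mul (hxmc.pow 2)).mul hxc)
  have hOUTCc : Continuous OUTC := continuous_const.mul ((continuous_const.mul (hxc.pow 2)).mul hxnc)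
  have hOUTPc : Continuous OUTP := continuous_const.mul ((hxc.pow 2).mul hyc)
  have hVISCc : Continuous VISC := continuous_const.mul (hxc.pow 2)
  -- single-mode energy balance: `G = ½x² − ∫IN + ∫OUTC + ∫OUTP + ∫VISC` is constant `= 0`
  set G : ℝ → ℝ := fun τ => (1 / 2 : ℝ) * x τ ^ 2 - (∫ u in (0 : ℝ)..τ, IN u) + (∫ u in (0 : ℝ)..τ, OUTC u) +
    (∫ u in (0 : ℝ)..τ, OUTP u) + ∫ u in (0 : ℝ)..τ, VISC u with hG
  have hprim : ∀ {f : ℝ → ℝ}, Continuous f → ∀ τ : ℝ,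
      HasDerivWithinAt (fun u => ∫ v in (0 : ℝ)..u, f v) (f τ) (Icc 0 s) τ := by
    intro f hf τ
    exact (intervalIntegral.integral_hasDerivAt_right (hf.intervalIntegrable _ _)
      (hf.stronglyMeasurableAtFilter _ _) hf.continuousAt).hasDerivWithinAt
  have hGd : ∀ τ ∈ Icc (0 : ℝ) s, HasDerivWithinAt G 0 (Icc 0 s) τ := by
    intro τ hτ
    have he : HasDerivWithinAt (fun u => (1 / 2 : ℝ) * x u ^ 2)
        ((1 / 2 : ℝ) * (((2 : ℕ) : ℝ) * x τ ^ (2 - 1) *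
          (c₀ * Λm * xm τ ^ 2 - c₀ * Λn * (x τ * xn τ) - P * Λn * (x τ * y τ) - κ * x τ))) (Icc 0 s) τ :=
      ((hxd τ hτ).pow 2).const_mul (1 / 2)
    have h := (((he.sub (hprim hINc τ)).add (hprim hOUTCc τ)).add (hprim hOUTPc τ)).add (hprim hVISCc τ)
    refine h.congr_deriv ?_
    simp only [hIN, hOUTC, hOUTP, hVISC]
    push_cast
    ring
  have hGc : ContinuousOn G (Icc 0 s) := fun τ hτ => (hGd τ hτ).continuousWithinAt
  have hGd' : ∀ u ∈ Ico (0 : ℝ) s, HasDerivWithinAt G 0 (Ici u) u := fun u hu =>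
    (hGd u (Ico_subset_Icc_self hu)).mono_of_mem_nhdsWithin
      (Filter.mem_of_superset (Icc_mem_nhdsGE hu.2) (Icc_subset_Icc hu.1 le_rfl))
  have hG0 : G 0 = 0 := by
    have : x 0 = 0 := by simp only [hx]; rw [hdat]; simp; omega
    simp [hG, this]
  intro t ht
  have hGt : G t = 0 := by
    have h := constant_of_has_deriv_right_zero hGc hGd' t ht
    rw [hG0] at h
    exact h
  -- dissipation `≥ 0`, stored energy `≥ 0`
  have hV : 0 ≤ ∫ u in (0 : ℝ)..t, VISC u :=
    intervalIntegral.integral_nonneg ht.1 fun u _ => mul_nonneg hκ0 (sq_nonneg _)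
  have hE : 0 ≤ (1 / 2 : ℝ) * x t ^ 2 := by positivity
  -- the pump work dominates `(P²/c₀²)·` the onward flux, pointwise hence in integral
  have hdom : P ^ 2 / c₀ ^ 2 * (∫ u in (0 : ℝ)..t, OUTC u) ≤ ∫ u in (0 : ℝ)..t, OUTP u := by
    rw [← intervalIntegral.integral_const_mul]
    refine intervalIntegral.integral_mono_on ht.1 ((hOUTCc.const_mul _).intervalIntegrable _ _)
      (hOUTPc.intervalIntegrable _ _) fun u hu => ?_
    have hus : u ∈ Icc (0 : ℝ) s := ⟨hu.1, hu.2.trans ht.2⟩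
    have hcmp : P / c₀ * xn u ≤ y u := by
      have h' := deadEndPump_side_ge hs hc hO hD hw hP hCz hε hν hc₀ hP0 hdat hode hnn (n := (m : ℤ) + 1)
        (by omega) u hus
      rwa [show ((m : ℤ) + 1 + 1) = (m : ℤ) + 2 by ring] at h'
    have hnonneg : 0 ≤ P * Λn * x u ^ 2 := by positivity
    have h := mul_le_mul_of_nonneg_left hcmp hnonneg
    have hid : P ^ 2 / c₀ ^ 2 * OUTC u = P * Λn * x u ^ 2 * (P / c₀ * xn u) := by
      simp only [hOUTC]
      field_simp
    rw [hid]
    simpa only [hOUTP, mul_assoc] using h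
  -- assemble
  have hsplit : (∫ u in (0 : ℝ)..t, OUTC u) + (∫ u in (0 : ℝ)..t, OUTP u) ≤ ∫ u in (0 : ℝ)..t, IN u := by
    simp only [hG] at hGt
    linarith
  have hOUTCnn : 0 ≤ ∫ u in (0 : ℝ)..t, OUTC u := by
    refine intervalIntegral.integral_nonneg ht.1 fun u hu => ?_
    have hus : u ∈ Icc (0 : ℝ) s := ⟨hu.1, hu.2.trans ht.2⟩
    have h1 : 0 ≤ xn u := hnn u hus 0 _ (by omega)
    simp only [hOUTC]
    positivity
  have key : (1 + P ^ 2 / c₀ ^ 2) * (∫ u in (0 : ℝ)..t, OUTC u) ≤ ∫ u in (0 : ℝ)..t, IN u := by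
    nlinarith
  simpa only [hOUTC, hIN, hx, hxm, hxn] using key

/-- **Geometric starvation of the bond fluxes**: `Φ_{m+1}(t) ≤ E₀·q^m`, `q = (1 + P²/c₀²)⁻¹`, for every bond
`m → m+1` and every `t ∈ [0,s]` (induction on `m`; the base `Φ_1 ≤ E₀` is the class-wide flux budget
`kpProper_bondFlux_budget`). [cite: Tao2016AveragedNS, §4 (4.8)–(4.9), (4.13)] -/
theorem deadEndPump_flux_le {ε₀ ν s : ℝ} (hε : 0 ≤ ε₀) (hν : 0 ≤ ν) (hc₀ : 0 < c₀) (hP0 : 0 ≤ P)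
    {X₀ : Fin 4 → ℝ} {X : Fin 4 → ℤ → ℝ → ℝ}
    (hdat : ∀ (i : Fin 4) (k : ℤ), X i k 0 = if k = 0 then X₀ i else 0)
    (hvan : ∀ (i : Fin 4) (k : ℤ), k < 0 → ∀ t : ℝ, X i k t = 0)
    (hXc : ∀ (i : Fin 4) (k : ℤ), Continuous (X i k))
    (hode : ∀ (i : Fin 4) (k : ℤ), ∀ t ∈ Icc (0 : ℝ) s, HasDerivWithinAt (X i k)
      (quadTerm ε₀ α X i k t - ν * (1 + ε₀) ^ ((2 : ℝ) * k) * X i k t) (Icc (0 : ℝ) s) t)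
    (hnn : ∀ t ∈ Icc (0 : ℝ) s, ∀ (i : Fin 4) (k : ℤ), 1 ≤ k → 0 ≤ X i k t) :
    ∀ m : ℕ, ∀ t ∈ Icc (0 : ℝ) s,
      ∫ τ in (0 : ℝ)..t, (1 + ε₀) ^ ((5 : ℝ) * (m : ℝ) / 2) * (c₀ * X 0 (m : ℤ) τ ^ 2 * X 0 ((m : ℤ) + 1) τ) ≤
        (∑ i, (1 / 2 : ℝ) * X₀ i ^ 2) * ((1 + P ^ 2 / c₀ ^ 2)⁻¹) ^ m := by
  have hr : 0 < 1 + P ^ 2 / c₀ ^ 2 := by positivity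
  intro m
  induction m with
  | zero =>
    intro t ht
    have h := kpProper_bondFlux_budget hs hc hO hD (by linarith) hν hdat hvan hXc hode 0 t ht
    simp only [deadEndPump_gateFlux hw] at h
    simpa using h
  | succ m ih =>
    intro t ht
    have hstep := deadEndPump_flux_step hs hc hO hD hw hP hCz hε hν hc₀ hP0 hdat hXc hode hnn m t ht
    have hih := ih t ht
    have hcast1 : (((m + 1 : ℕ) : ℝ)) = (m : ℝ) + 1 := by push_cast; ring
    have hcast2 : (((m + 1 : ℕ) : ℤ)) = (m : ℤ) + 1 := by push_cast; ring
    have hcast3 : ((m : ℤ) + 1 + 1) = (m : ℤ) + 2 := by ring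
    rw [hcast1, hcast2, hcast3]
    rw [pow_succ]
    have h2 : ∫ τ in (0 : ℝ)..t, (1 + ε₀) ^ ((5 : ℝ) * ((m : ℝ) + 1) / 2) *
        (c₀ * X 0 ((m : ℤ) + 1) τ ^ 2 * X 0 ((m : ℤ) + 2) τ) ≤
        (∫ τ in (0 : ℝ)..t, (1 + ε₀) ^ ((5 : ℝ) * (m : ℝ) / 2) *
          (c₀ * X 0 (m : ℤ) τ ^ 2 * X 0 ((m : ℤ) + 1) τ)) * (1 + P ^ 2 / c₀ ^ 2)⁻¹ := by
      rw [le_mul_inv_iff₀ hr, mul_comm]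
      exact hstep
    calc _ ≤ _ := h2
      _ ≤ (∑ i, (1 / 2 : ℝ) * X₀ i ^ 2) * ((1 + P ^ 2 / c₀ ^ 2)⁻¹) ^ m * (1 + P ^ 2 / c₀ ^ 2)⁻¹ :=
          mul_le_mul_of_nonneg_right hih (inv_nonneg.2 hr.le)
      _ = _ := by ring

end DeadEndPump

end Summit.NavierStokesRegularity.NavierStokesRegularity.Theorems

end
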